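import Mathlib
import HarnessLib
import Summits.HubbardSuperconductivity.HubbardSuperconductivity.Theorems.KLProgrammeKLRegimeSplitPhRotationPlanarWeighted
import Summits.HubbardSuperconductivity.HubbardSuperconductivity.Theorems.KLProgrammeC4aLevelChartInj

/-!
# Route `KLProgramme` — ENGINE (stmt-HubbardSuperconductivity-20437 `KLRegimeEngineV17F2`), row (c) binder #8 (★ v19 `hexLadMV`), value rows `RP/RQ`, brick O6i-d (part 1):
# THE RADIAL-CONSTANCY HYPOTHESIS OF THE ANGULARLY WEIGHTED ROTATION LEMMA, DISCHARGED FOR WEIGHTS OF THE FORM `V(arg q)·ψ(q)` —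
# the polar angle of the chart point `levelChart(ρ,ϑ)` is `ϑ` reduced to `(−π, π]`, so a `2π`-periodic angular profile reads `V(ϑ)` there
# (cell gate-hubbard-kl, seat hubbard-kl-k3c2-p2 g32, technique «thermal-bar induction n ≤ nScales β + 1 with EngineBoundsAtV4S sums»)

WHY.  O6i-a/b/c (`klpw_planar/lattice_rotation_weighted_le`, `klpw_phValue_row_weighted_le`) take a planar weight `w` with the radial-constancy hypothesis
`hw : w(levelChart μ K (ρ,ϑ)) = v(ϑ)` on the chart box.  The consumer's weight is the kernel product frozen radially at each Fermi-surface angle, i.e. a function of the POLAR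
ANGLE of the planar momentum: `w(q) = V(arg(q₁ + i q₂))·ψ(q)` with `ψ = 1` on the tube (a radial plateau, needed only for regularity at the origin / square boundary).  Since
`levelChart μ K (ρ,ϑ) = (u cos ϑ, u sin ϑ)` with `u > 0` (`levelRadius_pos`), `arg = toIocMod 2π (−π) ϑ` (`Complex.arg_exp_mul_I`), and a `2π`-periodic `V` reads `V(ϑ)`:

* `klpw_arg_levelChart` — `arg((levelChart μ K p).1 + (levelChart μ K p).2·I) = toIocMod 2π (−π) p.2` for `p.1 ∈ (−r, r)`;
* **`klpw_radialConstancy_of_arg`** — for `V` `2π`-periodic and any `ψ` with `ψ(levelChart μ K p) = 1` on the chart box: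
  `(fun q => V (arg (q.1 + q.2·I)) * ψ q) (levelChart μ K p) = V p.2` — the hypothesis `hw` of O6i-a/b/c with `v = V`.
Pure computation; no definitions; nothing asserts (c), K3 or superconductivity.  [cite: BenfattoGiulianiMastropietro2006, §2.4]
-/

noncomputable section

namespace Summit.HubbardSuperconductivity.HubbardSuperconductivity.Theorems.KLRegimeSplit

set_option linter.dupNamespace false -- summit = problem name (single-conjunct summit), D-0017

open Real Set Literature.MathematicalPhysics.QuantumLattice Literature.Probability.LatticeModels
open Literature.MathematicalPhysics.QuantumLattice.BandSectorCounting
open Summit.HubbardSuperconductivity.HubbardSuperconductivity.Theorems.TwoPointAssembly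
open Summit.HubbardSuperconductivity.HubbardSuperconductivity.Theorems.EngineV8
open Summit.HubbardSuperconductivity.HubbardSuperconductivity.Theorems.DispersionFlow
open Summit.HubbardSuperconductivity.HubbardSuperconductivity.Theorems.PerturbedFermiCurve
open Summit.HubbardSuperconductivity.HubbardSuperconductivity.Theorems.C4a

section Angle

variable {a b : ℝ} (B : BandBounds a b) {K : TrigPolyC4v} {A : ℝ}
  (hA : ∀ p : Momentum, ∀ j ≤ 2, ‖iteratedFDeriv ℝ j (frameShift K) p‖ ≤ A)
  {μ r : ℝ} (hlo : a < μ - r - A) (hhi : μ + r + A < b)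
include B hA hlo hhi

/-- **The polar angle of the chart point**: `arg((levelChart μ K p).1 + (levelChart μ K p).2·I) = toIocMod 2π (−π) p.2` for `p.1 ∈ (−r, r)` (the level radius is positive). -/
theorem klpw_arg_levelChart {p : ℝ × ℝ} (hp : p.1 ∈ Ioo (-r) r) :
    Complex.arg (((levelChart μ K p).1 : ℂ) + ((levelChart μ K p).2 : ℂ) * Complex.I) = toIocMod Real.two_pi_pos (-π) p.2 := by
  have hu : 0 < perturbedFermiRadius (fun k : Fin 2 → ℝ => -K.eval k) (μ + p.1) p.2 :=
    levelRadius_pos B hA (by linarith [hp.1]) (by linarith [hp.2]) p.2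
  rw [levelChart_apply]
  simp only
  have hz : (((perturbedFermiRadius (fun k : Fin 2 → ℝ => -K.eval k) (μ + p.1) p.2 * Real.cos p.2 : ℝ)) : ℂ) +
      (((perturbedFermiRadius (fun k : Fin 2 → ℝ => -K.eval k) (μ + p.1) p.2 * Real.sin p.2 : ℝ)) : ℂ) * Complex.I =
      ((perturbedFermiRadius (fun k : Fin 2 → ℝ => -K.eval k) (μ + p.1) p.2 : ℝ) : ℂ) * Complex.exp ((p.2 : ℂ) * Complex.I) := by
    rw [Complex.exp_mul_I]
    push_cast
    ring
  rw [hz, Complex.arg_real_mul _ hu, Complex.arg_exp_mul_I]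

/-- **Radial constancy of an angular weight** (the hypothesis `hw` of `klpw_planar_rotation_weighted_le` / `klpw_lattice_rotation_weighted_le` / `klpw_phValue_row_weighted_le`):
for a `2π`-periodic profile `V` and any `ψ` equal to `1` on the chart box,
`(fun q => V (arg (q.1 + q.2·I)) * ψ q) (levelChart μ K p) = V p.2` whenever `p.1 ∈ (−r, r)`. -/
theorem klpw_radialConstancy_of_arg (V : ℝ → ℝ) (hV : Function.Periodic V (2 * π)) (ψ : ℝ × ℝ → ℝ)
    (hψ : ∀ p : ℝ × ℝ, p.1 ∈ Ioo (-r) r → ψ (levelChart μ K p) = 1) {p : ℝ × ℝ} (hp : p.1 ∈ Ioo (-r) r) :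
    (fun q : ℝ × ℝ => V (Complex.arg ((q.1 : ℂ) + (q.2 : ℂ) * Complex.I)) * ψ q) (levelChart μ K p) = V p.2 := by
  simp only
  rw [klpw_arg_levelChart B hA hlo hhi hp, hψ p hp, mul_one, toIocMod, zsmul_eq_mul]
  have h := hV.sub_int_mul_eq (toIocDiv Real.two_pi_pos (-π) p.2) (x := p.2)
  rw [show p.2 - (toIocDiv Real.two_pi_pos (-π) p.2 : ℝ) * (2 * π) = p.2 - ↑(toIocDiv Real.two_pi_pos (-π) p.2) * (2 * π) from rfl] at h
  convert h using 2

end Angle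

end Summit.HubbardSuperconductivity.HubbardSuperconductivity.Theorems.KLRegimeSplit

end
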